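import Literature.InformationTheory.QuantumCodes.CSSEquivalence
import HarnessLib

/-!
# A CSS code with a disconnected Tanner graph is the direct sum of its fibre codes
# (sigma-indexed direct sums `⊕ᵢ Cᵢ` of CSS codes of DIFFERENT sizes; block labellings; fibre codes)

Calderbank–Rains–Shor–Sloane [CalderbankEtAl1998, §4]: "The direct sum of two additive codes is defined in
the natural way: `C ⊕ C′ = {uv : u ∈ C, v ∈ C′}` … combining `[[n,k,d]]` and `[[n′,k′,d′]]` codes to produce
an `[[n+n′, k+k′, d″]]` code, where `d″ = min{d,d′}`". Lin–Pryadko [LinPryadko2024, §4.3] use it for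
two-block group-algebra codes over an ARBITRARY finite group: "the row of matrix `H_X` labeled by the group
element `x ∈ G` is in the block associated with the double coset `G_a x G_b` … the same is true for the
`x` th row of matrix `H_Z`. Therefore, if … `G_aG_b ⊊ G`, the code `LP[a,b]` is decomposed into smaller
mutually disconnected subcodes associated with different double cosets in `G_a\G/G_b`. It is well known
that double cosets do not necessarily have the same sizes, so the individual double-coset subcodes are
not expected to be equivalent" (held text arXiv:2306.16400 chunk p0010 L1–13), "decomposition of the 2BGA
code into a direct sum of individual double-coset subcodes" (L34–36).

The tree's `CSSCode.directSum` (`CSSDirectSum.lean`) is the direct sum of a family of codes with ONE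
common index type (`Matrix.blockDiagonal`), enough for the abelian case where all coset subcodes are
copies of one code (`TwoBlockCosetDecomposition.lean`). For blocks of different sizes this file adds:

* **sigma-indexed direct sums** `CSSCode.directSum' C` of `C : (i : o) → CSSCode (RX i) (RZ i) (Q i)`
  (qubits `Σ i, Q i`, check matrices `Matrix.blockDiagonal'`), with the componentwise transport
  `blockDiagonal'_mulVec_eq_zero_iff`, `mem_rowSpace_blockDiagonal'_iff`, the maps `sigmaBlock` /
  `sigmaExtend`, `xLogical_directSum'_iff` (+ `Z`), the bounds `directSum'_dX_le_hammingNorm`,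
  `le_directSum'_dX` (+ `Z`), **`directSum'_k : k = Σᵢ kᵢ`**, **`cssMinDist_directSum' :
  d(⊕ Cᵢ) = ⨅ᵢ d(Cᵢ)`** in Tillich–Zémor's `ℕ∞` convention (`⊤` for a component without logicals), and
  the census form `directSum'_isCode : ⊕ [[nᵢ,kᵢ,dᵢ]] = [[Σ nᵢ, Σ kᵢ, min dᵢ]]`;
* **block (Tanner) labellings** of one code `C : CSSCode RX RZ Q`: maps `πX : RX → ι`, `πZ : RZ → ι`,
  `πQ : Q → ι` with `H^X r q ≠ 0 → πX r = πQ q` and `H^Z r q ≠ 0 → πZ r = πQ q` (`CSSCode.IsTannerLabelling`: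
  every edge of the Tanner graph joins a check and a qubit with the same label), the **fibre codes**
  `C.fiberCode h i` on the checks and qubits labelled `i` (check matrices = the submatrices of `H^X`, `H^Z`),
  and the identity `HX_submatrix_sigmaFiberEquiv` : along `Equiv.sigmaFiberEquiv` the check matrices of
  `C` ARE `blockDiagonal'` of the fibre codes' — so `C` is permutation equivalent (`CSSEquivalence.lean`) to
  `directSum' (C.fiberCode h)`; consequences **`k_eq_sum_fiberCode`**, **`cssMinDist_eq_iInf_fiberCode`**,
  `dX_le_fiberCode_dX`, `le_dX_of_fiberCode` (+ `Z`), `exists_xLogical_iff_fiberCode`;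
* **fibrewise transport**: a permutation equivalence `H'^X = H^X ∘ (ρX × σ)`, `H'^Z = H^Z ∘ (ρZ × σ)` that
  matches a fibre `i'` of `C'` with a fibre `i` of `C` restricts to a permutation equivalence of the two
  fibre codes (`fiberCode_HX_eq_submatrix`, `fiberCode_params_eq_of_submatrix`) — the shape of
  [LinPryadko2024, Statement 7].

All statements are theorems; no named facts, no instances. The two-block group-algebra instantiation
(double cosets, Statements 7–8) is `TwoBlockGADoubleCosets.lean`.

## References (locators read on the page)

* [CalderbankEtAl1998] A. R. Calderbank, E. M. Rains, P. W. Shor, N. J. A. Sloane, *Quantum error correction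
  via codes over GF(4)*, IEEE Trans. Inform. Theory 44 (1998) 1369 = arXiv:quant-ph/9608006, §4 "General
  constructions" (held text chunk p0013 L24–27: direct sum, `[[n+n′, k+k′, min{d,d′}]]`).
* [LinPryadko2024] H.-K. Lin, L. P. Pryadko, *Quantum two-block group algebra codes*, PRA 109 (2024) 022407 =
  arXiv:2306.16400, §4.3 (chunk p0010 L1–13 block structure and "mutually disconnected subcodes"; L34–36
  "direct sum of individual double-coset subcodes"; Statement 7, L47–51; App. proof, chunk p0018 L54–63).
* [TillichZemor2014] J.-P. Tillich, G. Zémor, IEEE Trans. IT 60 (2014) 1193 = arXiv:0903.0566, §2 and §5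
  (the `ℕ∞` minimum distance, `∞` for a code without logicals) — the tree's `cssMinDist`.
-/

namespace Literature.InformationTheory.QuantumCodes

open Matrix

/-! ### Sigma-indexed block-diagonal check matrices: kernel and row space are componentwise -/

section SigmaBlocks

variable {o : Type*} {R Q : o → Type*}

/-- The `i`-th block `(j ↦ v ⟨i, j⟩)` of a vector on the disjoint union `Σ i, Q i` (blocks of different sizes).
[cite: CalderbankEtAl1998, §4 "C ⊕ C′ = {uv : u ∈ C, v ∈ C′}" (arXiv:quant-ph/9608006 chunk p0013 L24)] -/
def sigmaBlock (v : (Σ i, Q i) → ZMod 2) (i : o) : Q i → ZMod 2 := fun j => v ⟨i, j⟩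

/-- `sigmaBlock v i j = v ⟨i, j⟩`. [cite: CalderbankEtAl1998, §4 (arXiv:quant-ph/9608006 chunk p0013 L24)] -/
@[simp] theorem sigmaBlock_apply (v : (Σ i, Q i) → ZMod 2) (i : o) (j : Q i) : sigmaBlock v i j = v ⟨i, j⟩ := rfl

/-- Extension by zero of a vector on the component `i₀` to the disjoint union (`u ↦ 0⋯0u0⋯0`).
[cite: CalderbankEtAl1998, §4 "C ⊕ C′ = {uv : u ∈ C, v ∈ C′}" (arXiv:quant-ph/9608006 chunk p0013 L24)] -/
def sigmaExtend [DecidableEq o] (i₀ : o) (u : Q i₀ → ZMod 2) : (Σ i, Q i) → ZMod 2 :=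
  fun p => Function.update (0 : (i : o) → Q i → ZMod 2) i₀ u p.1 p.2

/-- `sigmaExtend i₀ u ⟨i, j⟩ = (update 0 i₀ u) i j`. [cite: CalderbankEtAl1998, §4 (arXiv:quant-ph/9608006 chunk p0013 L24)] -/
theorem sigmaExtend_apply [DecidableEq o] (i₀ : o) (u : Q i₀ → ZMod 2) (p : Σ i, Q i) :
    sigmaExtend i₀ u p = Function.update (0 : (i : o) → Q i → ZMod 2) i₀ u p.1 p.2 := rfl

/-- The `i₀`-th block of the extension is `u`. [cite: CalderbankEtAl1998, §4 (arXiv:quant-ph/9608006 chunk p0013 L24)] -/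
@[simp] theorem sigmaBlock_sigmaExtend_self [DecidableEq o] (i₀ : o) (u : Q i₀ → ZMod 2) :
    sigmaBlock (sigmaExtend i₀ u) i₀ = u := by
  funext j
  simp [sigmaExtend_apply]

/-- The other blocks of the extension vanish. [cite: CalderbankEtAl1998, §4 (arXiv:quant-ph/9608006 chunk p0013 L24)] -/
theorem sigmaBlock_sigmaExtend_of_ne [DecidableEq o] {i₀ i : o} (h : i ≠ i₀) (u : Q i₀ → ZMod 2) :
    sigmaBlock (sigmaExtend i₀ u) i = 0 := by
  funext j
  simp [sigmaExtend_apply, Function.update_of_ne h]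

/-- A vector on the disjoint union is determined by its blocks.
[cite: CalderbankEtAl1998, §4 (arXiv:quant-ph/9608006 chunk p0013 L24)] -/
theorem eq_of_sigmaBlock_eq {v w : (Σ i, Q i) → ZMod 2} (h : ∀ i, sigmaBlock v i = sigmaBlock w i) : v = w := by
  funext ⟨i, j⟩
  exact congr_fun (h i) j

/-- Block-diagonal matrices act blockwise: `(diag(M) v)_{⟨i,r⟩} = (M_i v_i)_r`.
[cite: LinPryadko2024, §4.3 "the row of matrix H_X labeled by the group element x is in the block associated with the double coset" (arXiv:2306.16400 chunk p0010 L1–8)] -/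
theorem blockDiagonal'_mulVec_sigmaBlock [DecidableEq o] [Fintype o] [∀ i, Fintype (Q i)]
    (M : (i : o) → Matrix (R i) (Q i) (ZMod 2)) (v : (Σ i, Q i) → ZMod 2) (i : o) (r : R i) :
    (blockDiagonal' M *ᵥ v) ⟨i, r⟩ = (M i *ᵥ sigmaBlock v i) r := by
  simp only [mulVec, dotProduct]
  rw [← Finset.univ_sigma_univ, Finset.sum_sigma]
  rw [Fintype.sum_eq_single i]
  · simp
  · intro i' hi'
    exact Finset.sum_eq_zero fun j _ => by rw [blockDiagonal'_apply_ne M _ _ (Ne.symm hi'), zero_mul]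

/-- **Kernel is componentwise**: `diag(M) v = 0 ↔ ∀ i, M_i v_i = 0`.
[cite: LinPryadko2024, §4.3 (arXiv:2306.16400 chunk p0010 L1–13)] -/
theorem blockDiagonal'_mulVec_eq_zero_iff [DecidableEq o] [Fintype o] [∀ i, Fintype (Q i)]
    (M : (i : o) → Matrix (R i) (Q i) (ZMod 2)) (v : (Σ i, Q i) → ZMod 2) :
    blockDiagonal' M *ᵥ v = 0 ↔ ∀ i, M i *ᵥ sigmaBlock v i = 0 := by
  constructor
  · intro h i
    funext r
    have := congr_fun h ⟨i, r⟩
    rwa [blockDiagonal'_mulVec_sigmaBlock] at this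
  · intro h
    funext ⟨i, r⟩
    rw [blockDiagonal'_mulVec_sigmaBlock, h i]
    rfl

/-- Row combinations of a block-diagonal matrix are componentwise: `(w diag(M))_{⟨i,j⟩} = (w_i M_i)_j`.
[cite: LinPryadko2024, §4.3 (arXiv:2306.16400 chunk p0010 L1–13)] -/
theorem sigmaBlock_vecMul_blockDiagonal' [DecidableEq o] [Fintype o] [∀ i, Fintype (R i)]
    (M : (i : o) → Matrix (R i) (Q i) (ZMod 2)) (w : (Σ i, R i) → ZMod 2) (i : o) :
    sigmaBlock (w ᵥ* blockDiagonal' M) i = sigmaBlock w i ᵥ* M i := by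
  funext j
  simp only [sigmaBlock_apply, vecMul, dotProduct]
  rw [← Finset.univ_sigma_univ, Finset.sum_sigma]
  rw [Fintype.sum_eq_single i]
  · simp
  · intro i' hi'
    exact Finset.sum_eq_zero fun r _ => by rw [blockDiagonal'_apply_ne M _ _ hi', mul_zero]

/-- **Row space is componentwise**: `v ∈ rs diag(M) ↔ ∀ i, v_i ∈ rs M_i`.
[cite: LinPryadko2024, §4.3 (arXiv:2306.16400 chunk p0010 L1–13)] -/
theorem mem_rowSpace_blockDiagonal'_iff [DecidableEq o] [Fintype o] [∀ i, Fintype (R i)]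
    (M : (i : o) → Matrix (R i) (Q i) (ZMod 2)) (v : (Σ i, Q i) → ZMod 2) :
    v ∈ rowSpace (blockDiagonal' M) ↔ ∀ i, sigmaBlock v i ∈ rowSpace (M i) := by
  constructor
  · intro h i
    obtain ⟨w, hw⟩ := (mem_rowSpace_iff _ _).1 h
    exact (mem_rowSpace_iff _ _).2 ⟨sigmaBlock w i, by rw [← sigmaBlock_vecMul_blockDiagonal', hw]⟩
  · intro h
    choose w hw using fun i => (mem_rowSpace_iff _ _).1 (h i)
    refine (mem_rowSpace_iff _ _).2 ⟨fun p => w p.1 p.2, eq_of_sigmaBlock_eq fun i => ?_⟩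
    rw [sigmaBlock_vecMul_blockDiagonal', ← hw i]
    rfl

/-- The weight of a block is at most the weight of the whole vector.
[cite: CalderbankEtAl1998, §4 (arXiv:quant-ph/9608006 chunk p0013 L24–27)] -/
theorem hammingNorm_sigmaBlock_le [Fintype o] [∀ i, Fintype (Q i)] (v : (Σ i, Q i) → ZMod 2) (i : o) :
    hammingNorm (sigmaBlock v i) ≤ hammingNorm v := by
  unfold hammingNorm
  refine Finset.card_le_card_of_injOn (fun j => (⟨i, j⟩ : Σ i, Q i)) (fun j hj => ?_) (fun j₁ _ j₂ _ h => ?_)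
  · simpa using hj
  · simpa using h

/-- Extension by zero preserves the weight. [cite: CalderbankEtAl1998, §4 (arXiv:quant-ph/9608006 chunk p0013 L24–27)] -/
theorem hammingNorm_sigmaExtend [DecidableEq o] [Fintype o] [∀ i, Fintype (Q i)] (i₀ : o) (u : Q i₀ → ZMod 2) :
    hammingNorm (sigmaExtend i₀ u) = hammingNorm u := by
  unfold hammingNorm
  symm
  refine Finset.card_bij (fun j _ => (⟨i₀, j⟩ : Σ i, Q i)) (fun j hj => ?_) (fun j₁ _ j₂ _ h => ?_) (fun p hp => ?_)
  · simpa [sigmaExtend_apply] using hj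
  · simpa using h
  · obtain ⟨i, j⟩ := p
    simp only [Finset.mem_filter, Finset.mem_univ, true_and, sigmaExtend_apply] at hp
    by_cases hi : i = i₀
    · subst hi
      exact ⟨j, by simpa using hp, rfl⟩
    · exact absurd (by simp [Function.update_of_ne hi]) hp

/-- **Kernel of a block-diagonal matrix = product of the kernels** (a linear equivalence).
[cite: LinPryadko2024, §4.3 "decomposition of the 2BGA code into a direct sum of individual double-coset subcodes" (arXiv:2306.16400 chunk p0010 L34–36)] -/
noncomputable def pcCodeBlockDiagonal'Equiv [DecidableEq o] [Fintype o] [∀ i, Fintype (Q i)]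
    (M : (i : o) → Matrix (R i) (Q i) (ZMod 2)) :
    pcCode (blockDiagonal' M) ≃ₗ[ZMod 2] ((i : o) → pcCode (M i)) where
  toFun v := fun i => ⟨sigmaBlock v.1 i, (blockDiagonal'_mulVec_eq_zero_iff M v.1).1 v.2 i⟩
  map_add' _ _ := rfl
  map_smul' _ _ := rfl
  invFun u := ⟨fun p => (u p.1).1 p.2, (blockDiagonal'_mulVec_eq_zero_iff M _).2 fun i => (u i).2⟩
  left_inv _ := rfl
  right_inv _ := rfl

/-- `dim ker diag(M) = Σ_i dim ker M_i`. [cite: LinPryadko2024, §4.3 (arXiv:2306.16400 chunk p0010 L34–36)] -/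
theorem finrank_pcCode_blockDiagonal' [DecidableEq o] [Fintype o] [∀ i, Fintype (Q i)]
    (M : (i : o) → Matrix (R i) (Q i) (ZMod 2)) :
    Module.finrank (ZMod 2) (pcCode (blockDiagonal' M)) = ∑ i, Module.finrank (ZMod 2) (pcCode (M i)) := by
  rw [(pcCodeBlockDiagonal'Equiv M).finrank_eq, Module.finrank_pi_fintype]

end SigmaBlocks

/-! ### The direct sum of a finite family of CSS codes of different sizes -/

namespace CSSCode

section DirectSum

variable {o : Type*} {RX RZ Q : o → Type*} [Fintype o] [DecidableEq o] [∀ i, Fintype (Q i)]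

/-- **Direct sum** `⊕_i C_i` of CSS codes with component-dependent index types: qubits `Σ i, Q i`,
block-diagonal check matrices (`Matrix.blockDiagonal'`).
[cite: CalderbankEtAl1998, §4 "the direct sum of two quantum-error-correcting codes" (arXiv:quant-ph/9608006 chunk p0013 L24–27)] -/
def directSum' (C : (i : o) → CSSCode (RX i) (RZ i) (Q i)) : CSSCode (Σ i, RX i) (Σ i, RZ i) (Σ i, Q i) where
  HX := blockDiagonal' fun i => (C i).HX
  HZ := blockDiagonal' fun i => (C i).HZ
  comm := by
    rw [blockDiagonal'_transpose, ← blockDiagonal'_mul]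
    have : (fun i => (C i).HX * ((C i).HZ)ᵀ) = 0 := funext fun i => (C i).comm
    rw [this, blockDiagonal'_zero]

/-- `(directSum' C).HX = diag(H^X_i)`. [cite: CalderbankEtAl1998, §4 (arXiv:quant-ph/9608006 chunk p0013 L24–27)] -/
@[simp] theorem directSum'_HX (C : (i : o) → CSSCode (RX i) (RZ i) (Q i)) :
    (directSum' C).HX = blockDiagonal' fun i => (C i).HX := rfl

/-- `(directSum' C).HZ = diag(H^Z_i)`. [cite: CalderbankEtAl1998, §4 (arXiv:quant-ph/9608006 chunk p0013 L24–27)] -/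
@[simp] theorem directSum'_HZ (C : (i : o) → CSSCode (RX i) (RZ i) (Q i)) :
    (directSum' C).HZ = blockDiagonal' fun i => (C i).HZ := rfl

/-- The direct sum commutes with the `X ↔ Z` exchange (definitional).
[cite: CalderbankEtAl1998, §4 (arXiv:quant-ph/9608006 chunk p0013 L24–27)] -/
theorem directSum'_swap (C : (i : o) → CSSCode (RX i) (RZ i) (Q i)) :
    (directSum' C).swap = directSum' fun i => (C i).swap := rfl

/-! #### `X`-logicals of the sum versus the components -/

/-- `V` is an `X`-logical of `⊕ C_i` iff every block is in `ker H^Z_i` and SOME block is not in `rs H^X_i`.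
[cite: CalderbankEtAl1998, §4 (arXiv:quant-ph/9608006 chunk p0013 L24–27)] -/
theorem xLogical_directSum'_iff [∀ i, Fintype (RX i)] (C : (i : o) → CSSCode (RX i) (RZ i) (Q i))
    (V : (Σ i, Q i) → ZMod 2) :
    ((directSum' C).HZ *ᵥ V = 0 ∧ V ∉ (directSum' C).rowSpX) ↔
      ((∀ i, (C i).HZ *ᵥ sigmaBlock V i = 0) ∧ ∃ i, sigmaBlock V i ∉ (C i).rowSpX) := by
  rw [directSum'_HZ, blockDiagonal'_mulVec_eq_zero_iff, CSSCode.rowSpX, directSum'_HX,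
    mem_rowSpace_blockDiagonal'_iff, not_forall]

/-- From an `X`-logical of the sum, an `X`-logical of some component of no larger weight.
[cite: CalderbankEtAl1998, §4 "d″ = min{d, d′}" (arXiv:quant-ph/9608006 chunk p0013 L26)] -/
theorem exists_xLogical_sigmaBlock [∀ i, Fintype (RX i)] (C : (i : o) → CSSCode (RX i) (RZ i) (Q i))
    {V : (Σ i, Q i) → ZMod 2} (hV : (directSum' C).HZ *ᵥ V = 0) (hV' : V ∉ (directSum' C).rowSpX) :
    ∃ i, (C i).HZ *ᵥ sigmaBlock V i = 0 ∧ sigmaBlock V i ∉ (C i).rowSpX ∧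
      hammingNorm (sigmaBlock V i) ≤ hammingNorm V := by
  obtain ⟨hker, i, hi⟩ := (xLogical_directSum'_iff C V).1 ⟨hV, hV'⟩
  exact ⟨i, hker i, hi, hammingNorm_sigmaBlock_le V i⟩

/-- From an `X`-logical of a component, an `X`-logical of the sum of the same weight (extend by zero).
[cite: CalderbankEtAl1998, §4 "d″ = min{d, d′}" (arXiv:quant-ph/9608006 chunk p0013 L26)] -/
theorem xLogical_sigmaExtend [∀ i, Fintype (RX i)] (C : (i : o) → CSSCode (RX i) (RZ i) (Q i)) (i₀ : o)
    {u : Q i₀ → ZMod 2} (hu : (C i₀).HZ *ᵥ u = 0) (hu' : u ∉ (C i₀).rowSpX) :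
    (directSum' C).HZ *ᵥ sigmaExtend i₀ u = 0 ∧ sigmaExtend i₀ u ∉ (directSum' C).rowSpX := by
  refine (xLogical_directSum'_iff C _).2 ⟨fun i => ?_, i₀, ?_⟩
  · by_cases h : i = i₀
    · subst h
      rw [sigmaBlock_sigmaExtend_self]
      exact hu
    · rw [sigmaBlock_sigmaExtend_of_ne h, mulVec_zero]
  · rw [sigmaBlock_sigmaExtend_self]
    exact hu'

/-- The sum has an `X`-logical iff some component has one.
[cite: CalderbankEtAl1998, §4 (arXiv:quant-ph/9608006 chunk p0013 L24–27)] -/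
theorem exists_xLogical_directSum'_iff [∀ i, Fintype (RX i)] (C : (i : o) → CSSCode (RX i) (RZ i) (Q i)) :
    (∃ V, (directSum' C).HZ *ᵥ V = 0 ∧ V ∉ (directSum' C).rowSpX) ↔
      ∃ i, ∃ u, (C i).HZ *ᵥ u = 0 ∧ u ∉ (C i).rowSpX := by
  constructor
  · rintro ⟨V, hV, hV'⟩
    obtain ⟨i, h1, h2, -⟩ := exists_xLogical_sigmaBlock C hV hV'
    exact ⟨i, sigmaBlock V i, h1, h2⟩
  · rintro ⟨i, u, hu, hu'⟩
    exact ⟨sigmaExtend i u, xLogical_sigmaExtend C i hu hu'⟩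

/-- **`d^X(⊕ C_i) ≤ |u|`** for every `X`-logical `u` of any component.
[cite: CalderbankEtAl1998, §4 "d″ = min{d, d′}" (arXiv:quant-ph/9608006 chunk p0013 L26)] -/
theorem directSum'_dX_le_hammingNorm [∀ i, Fintype (RX i)] (C : (i : o) → CSSCode (RX i) (RZ i) (Q i)) (i₀ : o)
    {u : Q i₀ → ZMod 2} (hu : (C i₀).HZ *ᵥ u = 0) (hu' : u ∉ (C i₀).rowSpX) :
    (directSum' C).dX ≤ hammingNorm u := by
  have h := xLogical_sigmaExtend C i₀ hu hu'
  rw [← hammingNorm_sigmaExtend i₀ u]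
  exact (directSum' C).dX_le_hammingNorm h.1 h.2

/-- `d^X(⊕ C_i) ≤ d^X(C_{i₀})` for every component that has an `X`-logical.
[cite: CalderbankEtAl1998, §4 "d″ = min{d, d′}" (arXiv:quant-ph/9608006 chunk p0013 L26)] -/
theorem directSum'_dX_le [∀ i, Fintype (RX i)] (C : (i : o) → CSSCode (RX i) (RZ i) (Q i)) (i₀ : o)
    (hex : ∃ u, (C i₀).HZ *ᵥ u = 0 ∧ u ∉ (C i₀).rowSpX) : (directSum' C).dX ≤ (C i₀).dX := by
  obtain ⟨u, hu, hu', hud⟩ := (C i₀).exists_hammingNorm_eq_dX hex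
  rw [← hud]
  exact directSum'_dX_le_hammingNorm C i₀ hu hu'

/-- **Lower bound**: if every `X`-logical of every component has weight `≥ d` (and some component has one),
then `d ≤ d^X(⊕ C_i)`. [cite: CalderbankEtAl1998, §4 "d″ = min{d, d′}" (arXiv:quant-ph/9608006 chunk p0013 L26)] -/
theorem le_directSum'_dX [∀ i, Fintype (RX i)] (C : (i : o) → CSSCode (RX i) (RZ i) (Q i)) {d : ℕ}
    (hex : ∃ i, ∃ u, (C i).HZ *ᵥ u = 0 ∧ u ∉ (C i).rowSpX)
    (h : ∀ i u, (C i).HZ *ᵥ u = 0 → u ∉ (C i).rowSpX → d ≤ hammingNorm u) : d ≤ (directSum' C).dX := by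
  refine (directSum' C).le_dX ((exists_xLogical_directSum'_iff C).2 hex) fun V hV hV' => ?_
  obtain ⟨i, h1, h2, h3⟩ := exists_xLogical_sigmaBlock C hV hV'
  exact (h i _ h1 h2).trans h3

/-! #### `Z` side (via the `X ↔ Z` exchange) -/

/-- `V` is a `Z`-logical of `⊕ C_i` iff every block is in `ker H^X_i` and some block is not in `rs H^Z_i`.
[cite: CalderbankEtAl1998, §4 (arXiv:quant-ph/9608006 chunk p0013 L24–27)] -/
theorem zLogical_directSum'_iff [∀ i, Fintype (RZ i)] (C : (i : o) → CSSCode (RX i) (RZ i) (Q i))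
    (V : (Σ i, Q i) → ZMod 2) :
    ((directSum' C).HX *ᵥ V = 0 ∧ V ∉ (directSum' C).rowSpZ) ↔
      ((∀ i, (C i).HX *ᵥ sigmaBlock V i = 0) ∧ ∃ i, sigmaBlock V i ∉ (C i).rowSpZ) :=
  xLogical_directSum'_iff (fun i => (C i).swap) V

/-- `d^Z(⊕ C_i) ≤ |u|` for every `Z`-logical `u` of a component. [cite: CalderbankEtAl1998, §4 "d″ = min{d, d′}" (arXiv:quant-ph/9608006 chunk p0013 L26)] -/
theorem directSum'_dZ_le_hammingNorm [∀ i, Fintype (RZ i)] (C : (i : o) → CSSCode (RX i) (RZ i) (Q i)) (i₀ : o)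
    {u : Q i₀ → ZMod 2} (hu : (C i₀).HX *ᵥ u = 0) (hu' : u ∉ (C i₀).rowSpZ) :
    (directSum' C).dZ ≤ hammingNorm u :=
  directSum'_dX_le_hammingNorm (fun i => (C i).swap) i₀ hu hu'

/-- `d^Z(⊕ C_i) ≤ d^Z(C_{i₀})` for every component that has a `Z`-logical.
[cite: CalderbankEtAl1998, §4 "d″ = min{d, d′}" (arXiv:quant-ph/9608006 chunk p0013 L26)] -/
theorem directSum'_dZ_le [∀ i, Fintype (RZ i)] (C : (i : o) → CSSCode (RX i) (RZ i) (Q i)) (i₀ : o)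
    (hex : ∃ u, (C i₀).HX *ᵥ u = 0 ∧ u ∉ (C i₀).rowSpZ) : (directSum' C).dZ ≤ (C i₀).dZ :=
  directSum'_dX_le (fun i => (C i).swap) i₀ hex

/-- Lower bound on `d^Z(⊕ C_i)` from componentwise lower bounds. [cite: CalderbankEtAl1998, §4 "d″ = min{d, d′}" (arXiv:quant-ph/9608006 chunk p0013 L26)] -/
theorem le_directSum'_dZ [∀ i, Fintype (RZ i)] (C : (i : o) → CSSCode (RX i) (RZ i) (Q i)) {d : ℕ}
    (hex : ∃ i, ∃ u, (C i).HX *ᵥ u = 0 ∧ u ∉ (C i).rowSpZ)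
    (h : ∀ i u, (C i).HX *ᵥ u = 0 → u ∉ (C i).rowSpZ → d ≤ hammingNorm u) : d ≤ (directSum' C).dZ :=
  le_directSum'_dX (fun i => (C i).swap) hex h

/-- The sum has a `Z`-logical iff some component has one. [cite: CalderbankEtAl1998, §4 (arXiv:quant-ph/9608006 chunk p0013 L24–27)] -/
theorem exists_zLogical_directSum'_iff [∀ i, Fintype (RZ i)] (C : (i : o) → CSSCode (RX i) (RZ i) (Q i)) :
    (∃ V, (directSum' C).HX *ᵥ V = 0 ∧ V ∉ (directSum' C).rowSpZ) ↔
      ∃ i, ∃ u, (C i).HX *ᵥ u = 0 ∧ u ∉ (C i).rowSpZ :=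
  exists_xLogical_directSum'_iff fun i => (C i).swap

/-! #### Dimension and the `ℕ∞` minimum distance -/

/-- **`k(⊕ C_i) = Σ_i k(C_i)`**. [cite: CalderbankEtAl1998, §4 "an [[n + n′, k + k′, d″]] code" (arXiv:quant-ph/9608006 chunk p0013 L26)] -/
theorem directSum'_k [∀ i, Fintype (RX i)] [∀ i, Fintype (RZ i)] (C : (i : o) → CSSCode (RX i) (RZ i) (Q i)) :
    (directSum' C).k = ∑ i, (C i).k := by
  -- per component: `k + |Q i| = dim ker H^X + dim ker H^Z`
  have comp : ∀ i, (C i).k + Fintype.card (Q i) =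
      Module.finrank (ZMod 2) (pcCode (C i).HX) + Module.finrank (ZMod 2) (pcCode (C i).HZ) := by
    intro i
    have h1 := rank_add_finrank_pcCode (C i).HX
    have h2 := rank_add_finrank_pcCode (C i).HZ
    have h3 := (C i).rank_HX_add_rank_HZ_le
    have h4 := (C i).k_eq
    omega
  have hsum : (directSum' C).k + Fintype.card (Σ i, Q i) =
      Module.finrank (ZMod 2) (pcCode (directSum' C).HX) + Module.finrank (ZMod 2) (pcCode (directSum' C).HZ) := by
    have h1 := rank_add_finrank_pcCode (directSum' C).HX
    have h2 := rank_add_finrank_pcCode (directSum' C).HZ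
    have h3 := (directSum' C).rank_HX_add_rank_HZ_le
    have h4 := (directSum' C).k_eq
    omega
  rw [directSum'_HX, directSum'_HZ, finrank_pcCode_blockDiagonal', finrank_pcCode_blockDiagonal',
    Fintype.card_sigma, ← Finset.sum_add_distrib] at hsum
  have hc : ∑ i, ((C i).k + Fintype.card (Q i)) = (∑ i, (C i).k) + ∑ i, Fintype.card (Q i) :=
    Finset.sum_add_distrib
  have : ∑ i, (Module.finrank (ZMod 2) (pcCode (C i).HX) + Module.finrank (ZMod 2) (pcCode (C i).HZ)) =
      ∑ i, ((C i).k + Fintype.card (Q i)) := Finset.sum_congr rfl fun i _ => (comp i).symm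
  omega

omit [DecidableEq o] in
/-- The qubit count of the sum is `Σ_i n_i`. [cite: CalderbankEtAl1998, §4 "an [[n + n′, k + k′, d″]] code" (arXiv:quant-ph/9608006 chunk p0013 L26)] -/
theorem card_directSum'_qubits : Fintype.card (Σ i, Q i) = ∑ i, Fintype.card (Q i) := Fintype.card_sigma

/-- `k(⊕ C_i) > 0` iff some component has `k > 0`.
[cite: CalderbankEtAl1998, §4 "an [[n + n′, k + k′, d″]] code" (arXiv:quant-ph/9608006 chunk p0013 L26)] -/
theorem directSum'_k_pos_iff [∀ i, Fintype (RX i)] [∀ i, Fintype (RZ i)] (C : (i : o) → CSSCode (RX i) (RZ i) (Q i)) :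
    0 < (directSum' C).k ↔ ∃ i, 0 < (C i).k := by
  rw [directSum'_k]
  constructor
  · intro h
    by_contra hne
    have : ∑ i, (C i).k = 0 :=
      Finset.sum_eq_zero fun i _ => Nat.le_zero.1 (not_lt.1 fun hi => hne ⟨i, hi⟩)
    omega
  · rintro ⟨i, hi⟩
    exact lt_of_lt_of_le hi (Finset.single_le_sum (f := fun j => (C j).k) (fun j _ => Nat.zero_le _) (Finset.mem_univ i))

/-- **`d(⊕ C_i) = minᵢ d(C_i)`** for Tillich–Zémor's `ℕ∞`-valued CSS minimum distance (a component without
logical operators contributes `⊤`, so the components with `k = 0` are ignored automatically).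
[cite: CalderbankEtAl1998, §4 "d″ = min{d, d′}" (arXiv:quant-ph/9608006 chunk p0013 L26)]
[cite: TillichZemor2014, §5 (arXiv:0903.0566v1 chunk p0008 L3–4: distance ∞ of a code without logicals)] -/
theorem cssMinDist_directSum' [∀ i, Fintype (RX i)] [∀ i, Fintype (RZ i)] (C : (i : o) → CSSCode (RX i) (RZ i) (Q i)) :
    cssMinDist (directSum' C).HX (directSum' C).HZ = ⨅ i, cssMinDist (C i).HX (C i).HZ := by
  refine le_antisymm (le_iInf fun i => le_cssMinDist_iff.2 fun e he => ?_) (le_cssMinDist_iff.2 fun E hE => ?_)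
  · -- a logical `e` of `C i` extends to a logical of the sum of the same weight
    rw [← hammingNorm_sigmaExtend i e]
    rcases he with ⟨he, he'⟩ | ⟨he, he'⟩
    · have h := xLogical_sigmaExtend (fun j => (C j).swap) i (u := e) he he'
      exact cssMinDist_le_hammingNorm (Or.inl ⟨h.1, h.2⟩)
    · have h := xLogical_sigmaExtend C i (u := e) he he'
      exact cssMinDist_le_hammingNorm (Or.inr ⟨h.1, h.2⟩)
  · -- a logical `E` of the sum has a block that is a logical of some component, of no larger weight
    rcases hE with ⟨hE, hE'⟩ | ⟨hE, hE'⟩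
    · obtain ⟨i, h1, h2, h3⟩ := exists_xLogical_sigmaBlock (fun j => (C j).swap) (V := E) hE hE'
      exact (iInf_le _ i).trans ((cssMinDist_le_hammingNorm (Or.inl ⟨h1, h2⟩)).trans (Nat.cast_le.2 h3))
    · obtain ⟨i, h1, h2, h3⟩ := exists_xLogical_sigmaBlock C (V := E) hE hE'
      exact (iInf_le _ i).trans ((cssMinDist_le_hammingNorm (Or.inr ⟨h1, h2⟩)).trans (Nat.cast_le.2 h3))

/-- **Census form: `⊕ᵢ [[nᵢ, kᵢ, dᵢ]] = [[Σ nᵢ, Σ kᵢ, minᵢ dᵢ]]`** (all `kᵢ > 0`; `i₀` a component attaining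
the least `dᵢ`). [cite: CalderbankEtAl1998, §4 "combining [[n,k,d]] and [[n′,k′,d′]] codes to produce an [[n+n′, k+k′, d″]] code, where d″ = min{d,d′}" (arXiv:quant-ph/9608006 chunk p0013 L24–27)] -/
theorem directSum'_isCode [∀ i, Fintype (RX i)] [∀ i, Fintype (RZ i)] (C : (i : o) → CSSCode (RX i) (RZ i) (Q i))
    {n k d : o → ℕ} (h : ∀ i, (C i).IsCode (n i) (k i) (d i)) (i₀ : o) (hd : ∀ i, d i₀ ≤ d i) :
    (directSum' C).IsCode (∑ i, n i) (∑ i, k i) (d i₀) := by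
  refine ⟨by rw [Fintype.card_sigma]; exact Finset.sum_congr rfl fun i _ => (h i).1,
    by rw [directSum'_k]; exact Finset.sum_congr rfl fun i _ => (h i).2.1, ?_⟩
  rw [cssMinDist_directSum']
  refine le_antisymm ((iInf_le _ i₀).trans (h i₀).2.2.le) (le_iInf fun i => ?_)
  rw [(h i).2.2]
  exact Nat.cast_le.2 (hd i)

end DirectSum

/-! ### Block (Tanner) labellings of one code and its fibre codes -/

section Fibers

variable {RX RZ Q ι : Type*} [Fintype Q] (C : CSSCode RX RZ Q) (πX : RX → ι) (πZ : RZ → ι) (πQ : Q → ι)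

/-- A **block labelling** of the checks and qubits of a CSS code by a label set `ι`: every non-zero entry
`H^X_{rq}` / `H^Z_{rq}` joins a check `r` and a qubit `q` with the SAME label (every edge of the Tanner graph
stays inside one label class; the classes need not be connected). For `LP[a,b]` the labelling by double cosets
`G_a x G_b` is one. [cite: LinPryadko2024, §4.3 "the row of matrix H_X labeled by the group element x ∈ G is in the block associated with the double coset G_a x G_b … the same is true for the x th row of matrix H_Z" (arXiv:2306.16400 chunk p0010 L1–6)] -/
structure IsTannerLabelling : Prop where
  /-- `H^X_{rq} ≠ 0 ⟹ label r = label q` -/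
  labelX : ∀ r q, C.HX r q ≠ 0 → πX r = πQ q
  /-- `H^Z_{rq} ≠ 0 ⟹ label r = label q` -/
  labelZ : ∀ r q, C.HZ r q ≠ 0 → πZ r = πQ q

variable {C πX πZ πQ}

/-- The `X ↔ Z` exchange of a block labelling. [cite: LinPryadko2024, §4.3 (arXiv:2306.16400 chunk p0010 L1–6)] -/
theorem IsTannerLabelling.swap (h : C.IsTannerLabelling πX πZ πQ) : C.swap.IsTannerLabelling πZ πX πQ :=
  ⟨h.labelZ, h.labelX⟩

/-- An `X`-check labelled `i` only touches qubits labelled `i`.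
[cite: LinPryadko2024, §4.3 (arXiv:2306.16400 chunk p0010 L1–6)] -/
theorem IsTannerLabelling.HX_eq_zero (h : C.IsTannerLabelling πX πZ πQ) {r : RX} {q : Q} (hne : πX r ≠ πQ q) :
    C.HX r q = 0 := by
  by_contra hrq
  exact hne (h.labelX r q hrq)

/-- A `Z`-check labelled `i` only touches qubits labelled `i`.
[cite: LinPryadko2024, §4.3 (arXiv:2306.16400 chunk p0010 L1–6)] -/
theorem IsTannerLabelling.HZ_eq_zero (h : C.IsTannerLabelling πX πZ πQ) {r : RZ} {q : Q} (hne : πZ r ≠ πQ q) :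
    C.HZ r q = 0 := by
  by_contra hrq
  exact hne (h.labelZ r q hrq)

variable [DecidableEq ι]

/-- A sum over the qubits of an expression that vanishes off the label class `i` is the sum over the class.
[cite: LinPryadko2024, §4.3 (arXiv:2306.16400 chunk p0010 L1–13)] -/
theorem sum_fiber_eq_sum {M : Type*} [AddCommMonoid M] (f : Q → M) (i : ι) (hf : ∀ q, f q ≠ 0 → πQ q = i) :
    ∑ q : {q // πQ q = i}, f q = ∑ q, f q := by
  rw [← Finset.sum_subtype (Finset.univ.filter fun q => πQ q = i) (by simp) f,
    Finset.sum_filter_of_ne fun q _ hq => hf q hq]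

/-- The **fibre code** over the label `i`: the `X`-checks, `Z`-checks and qubits labelled `i`, with the check
matrices restricted (the "double-coset subcode" of [LinPryadko2024]). The commutation `H^X_i (H^Z_i)ᵀ = 0`
holds because a check labelled `i` has no support outside the class `i`.
[cite: LinPryadko2024, §4.3 "the code LP[a,b] is decomposed into smaller mutually disconnected subcodes associated with different double cosets" (arXiv:2306.16400 chunk p0010 L6–10)] -/
def fiberCode (h : C.IsTannerLabelling πX πZ πQ) (i : ι) :
    CSSCode {r // πX r = i} {r // πZ r = i} {q // πQ q = i} where
  HX := C.HX.submatrix Subtype.val Subtype.val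
  HZ := C.HZ.submatrix Subtype.val Subtype.val
  comm := by
    ext r z
    simp only [mul_apply, transpose_apply, submatrix_apply, Matrix.zero_apply]
    rw [sum_fiber_eq_sum (πQ := πQ) (fun q => C.HX r.1 q * C.HZ z.1 q) i fun q hq => ?_]
    · have := congr_fun (congr_fun C.comm r.1) z.1
      simpa [mul_apply] using this
    · exact (h.labelX _ _ (left_ne_zero_of_mul hq)).symm.trans r.2

/-- `(C.fiberCode h i).HX = H^X` restricted to the class `i`. [cite: LinPryadko2024, §4.3 (arXiv:2306.16400 chunk p0010 L6–10)] -/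
@[simp] theorem fiberCode_HX (h : C.IsTannerLabelling πX πZ πQ) (i : ι) :
    (C.fiberCode h i).HX = C.HX.submatrix Subtype.val Subtype.val := rfl

/-- `(C.fiberCode h i).HZ = H^Z` restricted to the class `i`. [cite: LinPryadko2024, §4.3 (arXiv:2306.16400 chunk p0010 L6–10)] -/
@[simp] theorem fiberCode_HZ (h : C.IsTannerLabelling πX πZ πQ) (i : ι) :
    (C.fiberCode h i).HZ = C.HZ.submatrix Subtype.val Subtype.val := rfl

/-- The fibre codes of the `X ↔ Z` exchange are the exchanged fibre codes (definitional).
[cite: LinPryadko2024, §4.3 (arXiv:2306.16400 chunk p0010 L1–10)] -/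
theorem fiberCode_swap (h : C.IsTannerLabelling πX πZ πQ) (i : ι) :
    (C.fiberCode h i).swap = C.swap.fiberCode h.swap i := rfl

/-- **`H^X` re-indexed by the label classes is block diagonal** with the fibre codes' `X`-check matrices as blocks
(along Mathlib's `Equiv.sigmaFiberEquiv : (Σ i, {r // π r = i}) ≃ RX`).
[cite: LinPryadko2024, §4.3 "we can ensure that elements of each double coset come together, so that decomposition of the 2BGA code into a direct sum of individual double-coset subcodes be evident" (arXiv:2306.16400 chunk p0010 L34–36)] -/
theorem HX_submatrix_sigmaFiberEquiv (h : C.IsTannerLabelling πX πZ πQ) :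
    C.HX.submatrix (Equiv.sigmaFiberEquiv πX) (Equiv.sigmaFiberEquiv πQ) =
      blockDiagonal' fun i => (C.fiberCode h i).HX := by
  ext ⟨i, r⟩ ⟨i', q⟩
  simp only [submatrix_apply, Equiv.sigmaFiberEquiv_apply, fiberCode_HX]
  by_cases hi : i = i'
  · subst hi
    rw [blockDiagonal'_apply_eq, submatrix_apply]
  · rw [blockDiagonal'_apply_ne _ _ _ hi]
    exact h.HX_eq_zero fun heq => hi (r.2.symm.trans (heq.trans q.2))

/-- **`H^Z` re-indexed by the label classes is block diagonal** with the fibre codes' `Z`-check matrices.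
[cite: LinPryadko2024, §4.3 (arXiv:2306.16400 chunk p0010 L4–6, L34–36)] -/
theorem HZ_submatrix_sigmaFiberEquiv (h : C.IsTannerLabelling πX πZ πQ) :
    C.HZ.submatrix (Equiv.sigmaFiberEquiv πZ) (Equiv.sigmaFiberEquiv πQ) =
      blockDiagonal' fun i => (C.fiberCode h i).HZ :=
  C.swap.HX_submatrix_sigmaFiberEquiv h.swap

variable [Fintype ι]

/-- `H^X` IS, up to the label-class bijections, the `X`-check matrix of the direct sum of the fibre codes.
[cite: LinPryadko2024, §4.3 (arXiv:2306.16400 chunk p0010 L34–36)] -/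
theorem HX_eq_submatrix_directSum'_fiberCode [Fintype RX] [Fintype RZ] (h : C.IsTannerLabelling πX πZ πQ) :
    C.HX = (directSum' (C.fiberCode h)).HX.submatrix (Equiv.sigmaFiberEquiv πX).symm (Equiv.sigmaFiberEquiv πQ).symm := by
  rw [directSum'_HX, ← C.HX_submatrix_sigmaFiberEquiv h, submatrix_submatrix]
  simp

/-- `H^Z` likewise. [cite: LinPryadko2024, §4.3 (arXiv:2306.16400 chunk p0010 L34–36)] -/
theorem HZ_eq_submatrix_directSum'_fiberCode [Fintype RX] [Fintype RZ] (h : C.IsTannerLabelling πX πZ πQ) :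
    C.HZ = (directSum' (C.fiberCode h)).HZ.submatrix (Equiv.sigmaFiberEquiv πZ).symm (Equiv.sigmaFiberEquiv πQ).symm := by
  rw [directSum'_HZ, ← C.HZ_submatrix_sigmaFiberEquiv h, submatrix_submatrix]
  simp

/-- **`k(C) = Σ_i k(fibre code i)`**: a CSS code with a block labelling is the direct sum of its fibre codes.
[cite: LinPryadko2024, §4.3 "decomposition of the 2BGA code into a direct sum of individual double-coset subcodes" (arXiv:2306.16400 chunk p0010 L34–36)]
[cite: CalderbankEtAl1998, §4 "an [[n + n′, k + k′, d″]] code" (arXiv:quant-ph/9608006 chunk p0013 L26)] -/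
theorem k_eq_sum_fiberCode [Fintype RX] [Fintype RZ] (h : C.IsTannerLabelling πX πZ πQ) :
    C.k = ∑ i, (C.fiberCode h i).k := by
  rw [CSSCode.k_eq_of_submatrix (C.HX_eq_submatrix_directSum'_fiberCode h) (C.HZ_eq_submatrix_directSum'_fiberCode h),
    directSum'_k]

/-- The qubit count splits by labels: `n = Σ_i n_i`. [cite: LinPryadko2024, §4.3 (arXiv:2306.16400 chunk p0010 L10–13: "double cosets do not necessarily have the same sizes")] -/
theorem card_eq_sum_card_fiber : Fintype.card Q = ∑ i, Fintype.card {q // πQ q = i} := by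
  rw [← Fintype.card_sigma]
  exact (Fintype.card_congr (Equiv.sigmaFiberEquiv πQ)).symm

/-- **`d(C) = minᵢ d(fibre code i)`** in Tillich–Zémor's `ℕ∞` convention (fibres without logicals count `⊤`).
[cite: LinPryadko2024, §4.3 (arXiv:2306.16400 chunk p0010 L6–13, L34–36)]
[cite: CalderbankEtAl1998, §4 "d″ = min{d, d′}" (arXiv:quant-ph/9608006 chunk p0013 L26)] -/
theorem cssMinDist_eq_iInf_fiberCode [Fintype RX] [Fintype RZ] (h : C.IsTannerLabelling πX πZ πQ) :
    cssMinDist C.HX C.HZ = ⨅ i, cssMinDist (C.fiberCode h i).HX (C.fiberCode h i).HZ := by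
  have hk := CSSCode.k_eq_of_submatrix (C.HX_eq_submatrix_directSum'_fiberCode h) (C.HZ_eq_submatrix_directSum'_fiberCode h)
  have hX := CSSCode.dX_eq_of_submatrix (C.HX_eq_submatrix_directSum'_fiberCode h) (C.HZ_eq_submatrix_directSum'_fiberCode h)
  have hZ := CSSCode.dZ_eq_of_submatrix (C.HX_eq_submatrix_directSum'_fiberCode h) (C.HZ_eq_submatrix_directSum'_fiberCode h)
  rw [← cssMinDist_directSum']
  by_cases h0 : C.k = 0
  · rw [C.cssMinDist_eq_top h0, (directSum' (C.fiberCode h)).cssMinDist_eq_top (hk ▸ h0)]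
  · have hpos : 0 < C.k := Nat.pos_of_ne_zero h0
    rw [C.cssMinDist_eq_min_dX_dZ hpos, (directSum' (C.fiberCode h)).cssMinDist_eq_min_dX_dZ (hk ▸ hpos), hX, hZ]

/-- `C` has an `X`-logical iff some fibre code has one. [cite: LinPryadko2024, §4.3 (arXiv:2306.16400 chunk p0010 L6–13)] -/
theorem exists_xLogical_iff_fiberCode [Fintype RX] [Fintype RZ] (h : C.IsTannerLabelling πX πZ πQ) :
    (∃ v, C.HZ *ᵥ v = 0 ∧ v ∉ C.rowSpX) ↔ ∃ i, ∃ u, (C.fiberCode h i).HZ *ᵥ u = 0 ∧ u ∉ (C.fiberCode h i).rowSpX := by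
  rw [← exists_xLogical_directSum'_iff, C.dX_pos_iff.symm, (directSum' (C.fiberCode h)).dX_pos_iff.symm,
    CSSCode.dX_eq_of_submatrix (C.HX_eq_submatrix_directSum'_fiberCode h) (C.HZ_eq_submatrix_directSum'_fiberCode h)]

/-- `C` has a `Z`-logical iff some fibre code has one. [cite: LinPryadko2024, §4.3 (arXiv:2306.16400 chunk p0010 L6–13)] -/
theorem exists_zLogical_iff_fiberCode [Fintype RX] [Fintype RZ] (h : C.IsTannerLabelling πX πZ πQ) :
    (∃ v, C.HX *ᵥ v = 0 ∧ v ∉ C.rowSpZ) ↔ ∃ i, ∃ u, (C.fiberCode h i).HX *ᵥ u = 0 ∧ u ∉ (C.fiberCode h i).rowSpZ := by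
  rw [← exists_zLogical_directSum'_iff, C.dZ_pos_iff.symm, (directSum' (C.fiberCode h)).dZ_pos_iff.symm,
    CSSCode.dZ_eq_of_submatrix (C.HX_eq_submatrix_directSum'_fiberCode h) (C.HZ_eq_submatrix_directSum'_fiberCode h)]

/-- **`d^X(C) ≤ d^X(fibre code i)`** for every fibre code that has an `X`-logical.
[cite: LinPryadko2024, §4.3 (arXiv:2306.16400 chunk p0010 L6–13)] [cite: CalderbankEtAl1998, §4 "d″ = min{d, d′}" (arXiv:quant-ph/9608006 chunk p0013 L26)] -/
theorem dX_le_fiberCode_dX [Fintype RX] [Fintype RZ] (h : C.IsTannerLabelling πX πZ πQ) (i : ι)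
    (hex : ∃ u, (C.fiberCode h i).HZ *ᵥ u = 0 ∧ u ∉ (C.fiberCode h i).rowSpX) : C.dX ≤ (C.fiberCode h i).dX := by
  rw [CSSCode.dX_eq_of_submatrix (C.HX_eq_submatrix_directSum'_fiberCode h) (C.HZ_eq_submatrix_directSum'_fiberCode h)]
  exact directSum'_dX_le _ i hex

/-- **`d^Z(C) ≤ d^Z(fibre code i)`** for every fibre code that has a `Z`-logical.
[cite: LinPryadko2024, §4.3 (arXiv:2306.16400 chunk p0010 L6–13)] [cite: CalderbankEtAl1998, §4 "d″ = min{d, d′}" (arXiv:quant-ph/9608006 chunk p0013 L26)] -/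
theorem dZ_le_fiberCode_dZ [Fintype RX] [Fintype RZ] (h : C.IsTannerLabelling πX πZ πQ) (i : ι)
    (hex : ∃ u, (C.fiberCode h i).HX *ᵥ u = 0 ∧ u ∉ (C.fiberCode h i).rowSpZ) : C.dZ ≤ (C.fiberCode h i).dZ := by
  rw [CSSCode.dZ_eq_of_submatrix (C.HX_eq_submatrix_directSum'_fiberCode h) (C.HZ_eq_submatrix_directSum'_fiberCode h)]
  exact directSum'_dZ_le _ i hex

/-- **Lower bound by fibres, `X` side**: if every `X`-logical of every fibre code has weight `≥ d` and some fibre code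
has one, then `d ≤ d^X(C)`. [cite: LinPryadko2024, §4.3 (arXiv:2306.16400 chunk p0010 L6–13)] [cite: CalderbankEtAl1998, §4 "d″ = min{d, d′}" (arXiv:quant-ph/9608006 chunk p0013 L26)] -/
theorem le_dX_of_fiberCode [Fintype RX] [Fintype RZ] (h : C.IsTannerLabelling πX πZ πQ) {d : ℕ}
    (hex : ∃ i, ∃ u, (C.fiberCode h i).HZ *ᵥ u = 0 ∧ u ∉ (C.fiberCode h i).rowSpX)
    (hd : ∀ i u, (C.fiberCode h i).HZ *ᵥ u = 0 → u ∉ (C.fiberCode h i).rowSpX → d ≤ hammingNorm u) : d ≤ C.dX := by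
  rw [CSSCode.dX_eq_of_submatrix (C.HX_eq_submatrix_directSum'_fiberCode h) (C.HZ_eq_submatrix_directSum'_fiberCode h)]
  exact le_directSum'_dX _ hex hd

/-- **Lower bound by fibres, `Z` side.** [cite: LinPryadko2024, §4.3 (arXiv:2306.16400 chunk p0010 L6–13)] [cite: CalderbankEtAl1998, §4 "d″ = min{d, d′}" (arXiv:quant-ph/9608006 chunk p0013 L26)] -/
theorem le_dZ_of_fiberCode [Fintype RX] [Fintype RZ] (h : C.IsTannerLabelling πX πZ πQ) {d : ℕ}
    (hex : ∃ i, ∃ u, (C.fiberCode h i).HX *ᵥ u = 0 ∧ u ∉ (C.fiberCode h i).rowSpZ)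
    (hd : ∀ i u, (C.fiberCode h i).HX *ᵥ u = 0 → u ∉ (C.fiberCode h i).rowSpZ → d ≤ hammingNorm u) : d ≤ C.dZ := by
  rw [CSSCode.dZ_eq_of_submatrix (C.HX_eq_submatrix_directSum'_fiberCode h) (C.HZ_eq_submatrix_directSum'_fiberCode h)]
  exact le_directSum'_dZ _ hex hd

/-- **Census form**: if every fibre code is an `[[nᵢ, kᵢ, dᵢ]]` code (`kᵢ > 0`) then `C` is
`[[Σ nᵢ, Σ kᵢ, minᵢ dᵢ]]`. [cite: CalderbankEtAl1998, §4 (arXiv:quant-ph/9608006 chunk p0013 L24–27)] [cite: LinPryadko2024, §4.3 (arXiv:2306.16400 chunk p0010 L34–36)] -/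
theorem isCode_of_fiberCode [Fintype RX] [Fintype RZ] [DecidableEq Q] (h : C.IsTannerLabelling πX πZ πQ)
    {n k d : ι → ℕ} (hc : ∀ i, (C.fiberCode h i).IsCode (n i) (k i) (d i)) (i₀ : ι) (hd : ∀ i, d i₀ ≤ d i) :
    C.IsCode (∑ i, n i) (∑ i, k i) (d i₀) :=
  (CSSCode.isCode_iff_of_submatrix (C.HX_eq_submatrix_directSum'_fiberCode h) (C.HZ_eq_submatrix_directSum'_fiberCode h)
    _ _ _).2 (directSum'_isCode _ hc i₀ hd)

end Fibers

/-! ### Fibrewise transport of a permutation equivalence -/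

section Transport

variable {RX RZ Q RX' RZ' Q' ι ι' : Type*} [Fintype Q] [Fintype Q'] [DecidableEq ι] [DecidableEq ι']
variable {C : CSSCode RX RZ Q} {C' : CSSCode RX' RZ' Q'} {πX : RX → ι} {πZ : RZ → ι} {πQ : Q → ι}
  {πX' : RX' → ι'} {πZ' : RZ' → ι'} {πQ' : Q' → ι'} {ρX : RX' ≃ RX} {ρZ : RZ' ≃ RZ} {σ : Q' ≃ Q} {i : ι} {i' : ι'}

/-- If a permutation equivalence `H'^X = H^X ∘ (ρX × σ)` maps the `X`-checks / qubits of `C'` labelled `i'`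
exactly onto those of `C` labelled `i`, the fibre code `i'` of `C'` has the `X`-check matrix of the fibre code
`i` of `C` re-indexed by the restricted bijections. [cite: LinPryadko2024, Statement 7 and App. proof "this invertible map sends the original double coset G_a x G_b to G_a x G_b x⁻¹" (arXiv:2306.16400 chunk p0010 L47–51, p0018 L56–63)] -/
theorem fiberCode_HX_eq_submatrix (h : C.IsTannerLabelling πX πZ πQ) (h' : C'.IsTannerLabelling πX' πZ' πQ')
    (hρX : ∀ r, πX' r = i' ↔ πX (ρX r) = i) (hσ : ∀ q, πQ' q = i' ↔ πQ (σ q) = i)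
    (hX : C'.HX = C.HX.submatrix ρX σ) :
    (C'.fiberCode h' i').HX = (C.fiberCode h i).HX.submatrix (ρX.subtypeEquiv hρX) (σ.subtypeEquiv hσ) := by
  ext r q
  simp [fiberCode_HX, hX, Equiv.coe_subtypeEquiv_eq_map]

/-- The `Z`-check twin of `fiberCode_HX_eq_submatrix`. [cite: LinPryadko2024, Statement 7 (arXiv:2306.16400 chunk p0010 L47–51, p0018 L56–63)] -/
theorem fiberCode_HZ_eq_submatrix (h : C.IsTannerLabelling πX πZ πQ) (h' : C'.IsTannerLabelling πX' πZ' πQ')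
    (hρZ : ∀ r, πZ' r = i' ↔ πZ (ρZ r) = i) (hσ : ∀ q, πQ' q = i' ↔ πQ (σ q) = i)
    (hZ : C'.HZ = C.HZ.submatrix ρZ σ) :
    (C'.fiberCode h' i').HZ = (C.fiberCode h i).HZ.submatrix (ρZ.subtypeEquiv hρZ) (σ.subtypeEquiv hσ) := by
  ext r q
  simp [fiberCode_HZ, hZ, Equiv.coe_subtypeEquiv_eq_map]

/-- **Fibrewise transport**: under a label-matching permutation equivalence the two fibre codes have the same
`d^X`, `d^Z` and `k`. [cite: LinPryadko2024, Statement 7 "A subcode of a disconnected 2BGA code LP[a,b] … supported in the double coset G_a x G_b … is equivalent to a subcode of LP[a, xbx⁻¹] supported in the double coset G_a 1 G_{xbx⁻¹}" (arXiv:2306.16400 chunk p0010 L47–51)] -/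
theorem fiberCode_params_eq_of_submatrix [Fintype RX] [Fintype RZ] [Fintype RX'] [Fintype RZ']
    (h : C.IsTannerLabelling πX πZ πQ) (h' : C'.IsTannerLabelling πX' πZ' πQ')
    (hρX : ∀ r, πX' r = i' ↔ πX (ρX r) = i) (hρZ : ∀ r, πZ' r = i' ↔ πZ (ρZ r) = i)
    (hσ : ∀ q, πQ' q = i' ↔ πQ (σ q) = i) (hX : C'.HX = C.HX.submatrix ρX σ) (hZ : C'.HZ = C.HZ.submatrix ρZ σ) :
    (C'.fiberCode h' i').dX = (C.fiberCode h i).dX ∧ (C'.fiberCode h' i').dZ = (C.fiberCode h i).dZ ∧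
      (C'.fiberCode h' i').k = (C.fiberCode h i).k :=
  ⟨CSSCode.dX_eq_of_submatrix (fiberCode_HX_eq_submatrix h h' hρX hσ hX) (fiberCode_HZ_eq_submatrix h h' hρZ hσ hZ),
   CSSCode.dZ_eq_of_submatrix (fiberCode_HX_eq_submatrix h h' hρX hσ hX) (fiberCode_HZ_eq_submatrix h h' hρZ hσ hZ),
   CSSCode.k_eq_of_submatrix (fiberCode_HX_eq_submatrix h h' hρX hσ hX) (fiberCode_HZ_eq_submatrix h h' hρZ hσ hZ)⟩

/-- … and the same `[[n,k,d]]` predicate. [cite: LinPryadko2024, Statement 7 (arXiv:2306.16400 chunk p0010 L47–51)] -/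
theorem fiberCode_isCode_iff_of_submatrix [Fintype RX] [Fintype RZ] [Fintype RX'] [Fintype RZ'] [DecidableEq Q]
    [DecidableEq Q'] (h : C.IsTannerLabelling πX πZ πQ) (h' : C'.IsTannerLabelling πX' πZ' πQ')
    (hρX : ∀ r, πX' r = i' ↔ πX (ρX r) = i) (hρZ : ∀ r, πZ' r = i' ↔ πZ (ρZ r) = i)
    (hσ : ∀ q, πQ' q = i' ↔ πQ (σ q) = i) (hX : C'.HX = C.HX.submatrix ρX σ) (hZ : C'.HZ = C.HZ.submatrix ρZ σ)
    (n k d : ℕ) : (C'.fiberCode h' i').IsCode n k d ↔ (C.fiberCode h i).IsCode n k d :=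
  CSSCode.isCode_iff_of_submatrix (fiberCode_HX_eq_submatrix h h' hρX hσ hX) (fiberCode_HZ_eq_submatrix h h' hρZ hσ hZ) n k d

end Transport

end CSSCode

end Literature.InformationTheory.QuantumCodes
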